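import Literature.AnabelianGeometry.EtaleTheta.ThetaCohomologyCuspSectionPoints
import Literature.AnabelianGeometry.EtaleTheta.SettingModelChiSectionPoints
import Literature.AnabelianGeometry.EtaleTheta.SettingModelChiThetaCocycleSec
import HarnessLib

/-!
# The cusped χ-model `modelχ′`: a NON-CUSPIDAL section point of `Ÿ(K̈)` and the choice `X̲̲ := Huuχ p l` as a
# `DoubleUnderline` over the section Kummer datum `kummerDataχ′Sec` — the §1/§2 data R312 needs, CONSTRUCTED at `χ′`

S. Mochizuki, *The étale theta function and its Frobenioid-theoretic manifestations*, Publ. RIMS **45** (2009) [EtTh], §1: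
Prop. 1.4 (iii) p. 22 («if `y ∈ Ÿ(L)` is a non-cuspidal point, then the restricted classes … lie in `L^×`»), Prop. 1.5 p. 23;
§2: Def. 2.5 (i) p. 39, Def. 2.7 p. 41 («`X̲̲ → X` … upon restriction to `Ÿ̲̲` the class `η̈^Θ` determines a class in
`H¹(Π^tp_{Ÿ̲̲}, l·Δ_Θ)`») [cite: MochizukiEtTh2009, Def 2.7 p.41]. Cell abc-iut, layer L2, seat abc-iut-L2-t10 (gen 6), row
«R312 CAPSTONE AT χ′» (sequel of R450 (2)/R461; abc-iut-L2-d3 g6's audit INFO on p452859: «no `E.DoubleUnderline` over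
`modelχ′` is CONSTRUCTED in the tree yet»).

KERNEL FACT USED THROUGHOUT: the cusped record `ThetaSetting.modelχ′ p` (abc-iut-w5-d140, `SettingModelChiThetaCusp`) has THE
SAME `Π^tp_X`, `Π^tp_Y`, `Π^tp_Ÿ`, `G_K`, `G_K̈`, `K̈`, `q̈`, `Δ_Θ`, `l·Δ_Θ`, `toTheta`, `toZ` and `H¹` carriers as
`ThetaSetting.modelχ p` — all `rfl` (only the point/cusp datum of `curveχ′` differs) — so abc-iut-L2-t6's SECTION chain of
`SettingModelChiSectionPoints` (F7b) and abc-iut-L2-d1's `X̲̲`-constructor of `SettingModelChiThetaDoubleUnderline` /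
`SettingModelChiThetaCocycle(Sec)` re-type VERBATIM over abc-iut-w5-d171's cusped core `kummerCoreχ′` and abc-iut-L2-t6 g7's
`kummerDataχ′Sec` (`ThetaCohomologyCuspSectionPoints`, imported — NOT re-declared):

* **`nonCuspidalPointχ′ : NonCuspidalPoint (kummerDataχ′Sec p)`** — `D_y := inr(G_{ℚ_p})`, `Ü(y) := 1 + p` (off `±q̈^ℤ`),
  evaluation = pull-back along `inr` (abc-iut-L2-t6's `nonCuspidalPointOfCoreSection`); `Dpt_…`, `coord_…` (`rfl`),
  `nonempty_nonCuspidalPoint_kummerDataχ'Sec`;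
* **`EtaleThetaData.doubleUnderlineχ′OfEtaRes l hl (E : (modelχ′ p).EtaleThetaData) (heta) : E.DoubleUnderline l`** — the
  choice `Π^tp_{X̲̲} := Huuχ p l` for ANY étale-theta datum over `modelχ′`, the six group-theoretic clauses by abc-iut-L2-d1's
  `modelχ` theorems (`isOpen_Huuχ`, `map_aug_GtpYdd_inf_Huuχ`, `map_toZ_Huuχ_modelχ`, `relIndex_Huuχ_GtpY_modelχ`,
  `map_toTheta_Huuχ_modelχ`), the one `E`-dependent clause `eta_res` as the hypothesis `heta` (abc-iut-L2-d3's suggested shape);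
* **`doubleUnderlineχ′Sec l hl : ((kummerDataχ′Sec p).etaleThetaDataOfClass (etaDdχ p)).DoubleUnderline l`** — for the datum
  carrying the model's OWN theta class `η̈^Θ := etaDdχ` (abc-iut-L2-d1; non-trivial, `etaDdχ_ne_one`), `eta_res` := abc-iut-L2-d1's
  `eta_res_thetaCocycleχ` literally; `doubleUnderlineχ'Sec_Huu : … .Huu = Huuχ p l` (`rfl`);
* census `exists_etaleThetaData_doubleUnderline_nonCuspidalPoint_modelχ'`: at `modelχ′`, for every odd `l`, an étale-theta
  datum with `E.toKummerData = kummerDataχ′Sec`, `η̈^Θ ≠ 1`, `Prop13 E`, an `X̲̲` with `Π^tp_{X̲̲} = Huuχ p l`, and a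
  non-cuspidal point — all CONSTRUCTED.

HONEST LIMITS: semi-synthetic model (χ-twisted root with one synthetic toral cusp) = consistency evidence for the typed interface
only; the `½`-groups of `etaleThetaDataOfClass` are honest-degenerate; class (b): three definitions on the EXISTING frozen
structures `NonCuspidalPoint` / `DoubleUnderline` (no new structure, no instance, no `Prop` fact, no interface clause touched);
nothing of [EtTh] asserted; no side taken on [IUTchIII] Cor. 3.12; typed ≠ proved; instantiated ≠ endorsed.
-/

noncomputable section

namespace Literature.AnabelianGeometry.EtaleTheta

open Literature.AnabelianGeometry.SemiGraphs

/-! ### The choice `X̲̲ := Huuχ p l` over ANY étale-theta datum of the cusped model -/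

/-- **The choice `X̲̲ := Huuχ p l` at the CUSPED χ-model is an `E.DoubleUnderline l`** for every étale-theta datum `E` over
`modelχ′` and every odd `l`, GIVEN the single `E`-dependent clause «upon restriction to `Ÿ̲̲ → Ÿ` the class `η̈^Θ` determines a
class in `H¹(Π^tp_{Ÿ̲̲}, l·Δ_Θ)`» (Def. 2.7) — abc-iut-L2-d1's `doubleUnderlineχOfEtaRes` re-typed at `modelχ′` (the six
group-theoretic fields are abc-iut-L2-d1's `modelχ` theorems verbatim: same carriers). [cite: MochizukiEtTh2009, Def 2.7 p.41] -/
def ThetaSetting.EtaleThetaData.doubleUnderlineχ'OfEtaRes (p : ℕ) [Fact p.Prime]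
    (l : ℕ+) (hl : Odd (l : ℕ)) (E : (ThetaSetting.modelχ' p).EtaleThetaData)
    (heta : ∃ (f : ↥((ThetaSetting.modelχ' p).GtpYdd ⊓ SettingModel.Huuχ p l) → (ThetaSetting.modelχ' p).DeltaTheta)
        (hf : f ∈ contCocycles (ThetaSetting.modelχ' p).toTheta (ThetaSetting.modelχ' p).DeltaTheta
          ((ThetaSetting.modelχ' p).GtpYdd ⊓ SettingModel.Huuχ p l)),
        (∀ g, (f g : (ThetaSetting.modelχ' p).GtpTheta) ∈ (ThetaSetting.modelχ' p).lDeltaTheta l) ∧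
          ContH1.mk f hf =
            ContH1.res (ThetaSetting.modelχ' p).toTheta (ThetaSetting.modelχ' p).DeltaTheta inf_le_left E.etaDd) :
    E.DoubleUnderline l where
  l_odd := hl
  Huu := SettingModel.Huuχ p l
  isOpen_Huu := SettingModel.isOpen_Huuχ p l
  map_aug_Ydduu := SettingModel.map_aug_GtpYdd_inf_Huuχ p l
  map_toZ_Huu := SettingModel.map_toZ_Huuχ_modelχ p l
  relIndex_Huu_GtpY := SettingModel.relIndex_Huuχ_GtpY_modelχ p l
  map_toTheta_Huu := SettingModel.map_toTheta_Huuχ_modelχ p l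
  eta_res := heta

/-- Its `Π^tp_{X̲̲}` is `Huuχ p l` (by construction). [cite: MochizukiEtTh2009, Def 2.7 p.41] -/
theorem ThetaSetting.EtaleThetaData.doubleUnderlineχ'OfEtaRes_Huu (p : ℕ) [Fact p.Prime]
    (l : ℕ+) (hl : Odd (l : ℕ)) (E : (ThetaSetting.modelχ' p).EtaleThetaData) (heta) :
    (E.doubleUnderlineχ'OfEtaRes p l hl heta).Huu = SettingModel.Huuχ p l := rfl

namespace SettingModel

open ThetaSetting

variable (p : ℕ) [Fact p.Prime]

/-! ### A non-cuspidal section point of `Ÿ(K̈)` at the cusped model -/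

/-- **A non-cuspidal `K̈`-point of `Ÿ` at `modelχ′`** for the section Kummer datum `kummerDataχ′Sec`: decomposition group the
Galois factor `inr(G_{ℚ_p})`, coordinate `Ü(y) := 1 + p` (off the cusps `±q̈^a`), evaluation `H¹(D_y, Δ_Θ) → H¹(G_K̈, Δ_Θ)` the
pull-back along `inr` — abc-iut-L2-t6's `nonCuspidalPointχ` re-typed over the cusped core. [cite: MochizukiEtTh2009, Prop 1.4 (iii) p.22] -/
def nonCuspidalPointχ' : NonCuspidalPoint (kummerDataχ'Sec p) :=
  (kummerCoreχ' p).nonCuspidalPointOfCoreSection SemidirectProduct.inr (continuous_inr_modelχ p)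
    (aug_modelχ_inr p) (map_inr_GK_le_GtpY_modelχ p) (map_inr_GKdd_le_GtpYdd_modelχ p) (onePlusP p)
    (onePlusP_ne_cusp p)

/-- Its decomposition group is `inr(G_K̈) = inr(G_{ℚ_p})`. [cite: MochizukiEtTh2009, Prop 1.4 (iii) p.22] -/
theorem Dpt_nonCuspidalPointχ' :
    (nonCuspidalPointχ' p).Dpt = (ThetaSetting.modelχ' p).GKdd.map (SemidirectProduct.inr : GQp p →* PiTpχ p) := rfl

/-- Its coordinate is `1 + p`. [cite: MochizukiEtTh2009, Prop 1.4 (iii) p.22] -/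
@[simp] theorem coord_nonCuspidalPointχ' : (nonCuspidalPointχ' p).coord = onePlusP p := rfl

/-- **CENSUS: `NonCuspidalPoint` WITNESSED at `modelχ′`** (for the section Kummer datum). [cite: MochizukiEtTh2009, Prop 1.4 (iii) p.22] -/
theorem nonempty_nonCuspidalPoint_kummerDataχ'Sec : Nonempty (NonCuspidalPoint (kummerDataχ'Sec p)) :=
  ⟨nonCuspidalPointχ' p⟩

/-! ### The choice `X̲̲` for the datum carrying the model's own theta class -/

/-- **The choice `X̲̲ := Huuχ p l` for the SECTION datum of `modelχ′` carrying the model's theta class `η̈^Θ = etaDdχ`** (all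
clauses of abc-iut-L2-t8's `DoubleUnderline`; `eta_res` by abc-iut-L2-d1's `eta_res_thetaCocycleχ`, which re-types at `modelχ′`).
[cite: MochizukiEtTh2009, Def 2.7 p.41] -/
def doubleUnderlineχ'Sec (l : ℕ+) (hl : Odd (l : ℕ)) :
    ((kummerDataχ'Sec p).etaleThetaDataOfClass (etaDdχ p)).DoubleUnderline l :=
  ThetaSetting.EtaleThetaData.doubleUnderlineχ'OfEtaRes p l hl _ (eta_res_thetaCocycleχ p l)

/-- [cite: MochizukiEtTh2009, Def 2.7 p.41] -/
theorem doubleUnderlineχ'Sec_Huu (l : ℕ+) (hl : Odd (l : ℕ)) : (doubleUnderlineχ'Sec p l hl).Huu = Huuχ p l := rfl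

/-- The étale-theta datum of `doubleUnderlineχ′Sec` sits over the section Kummer datum and carries the NON-TRIVIAL class
`η̈^Θ = etaDdχ` (abc-iut-L2-d1's `etaDdχ_ne_one`), with Prop. 1.3 as typed. [cite: MochizukiEtTh2009, Prop 1.3 p.20] -/
theorem etaleThetaDataOfClass_etaDdχ_modelχ' :
    ((kummerDataχ'Sec p).etaleThetaDataOfClass (etaDdχ p)).toKummerData = kummerDataχ'Sec p ∧
      ((kummerDataχ'Sec p).etaleThetaDataOfClass (etaDdχ p)).etaDd ≠ 1 ∧
        Prop13 ((kummerDataχ'Sec p).etaleThetaDataOfClass (etaDdχ p)) :=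
  ⟨rfl, etaDdχ_ne_one p, (kummerDataχ'Sec p).prop13_etaleThetaDataOfClass _⟩

/-- **CENSUS at `modelχ′` (the §1/§2 data of R312, all CONSTRUCTED)**: for every odd `l` there are an étale-theta datum `E`
over the cusped χ-model with `E.toKummerData = kummerDataχ′Sec`, `η̈^Θ ≠ 1` and `Prop13 E`, a choice `X̲̲` with
`Π^tp_{X̲̲} = Huuχ p l`, and a non-cuspidal point of `Ÿ(K̈)`. [cite: MochizukiEtTh2009, Def 2.7 p.41] -/
theorem exists_etaleThetaData_doubleUnderline_nonCuspidalPoint_modelχ' (l : ℕ+) (hl : Odd (l : ℕ)) :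
    ∃ (E : (ThetaSetting.modelχ' p).EtaleThetaData) (C : E.DoubleUnderline l),
      E.toKummerData = kummerDataχ'Sec p ∧ E.etaDd ≠ 1 ∧ Prop13 E ∧ C.Huu = Huuχ p l ∧
        Nonempty (NonCuspidalPoint E.toKummerData) :=
  ⟨_, doubleUnderlineχ'Sec p l hl, rfl, etaDdχ_ne_one p, (kummerDataχ'Sec p).prop13_etaleThetaDataOfClass _, rfl,
    ⟨nonCuspidalPointχ' p⟩⟩

end SettingModel

end Literature.AnabelianGeometry.EtaleTheta

end
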